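import Summits.KontsevichZagierPeriods.KontsevichZagierPeriods.Theorems.HurwitzMicroSectorsNormalFormPrincipleDilogExistsBoxAtoms
import Literature.NumberTheory.Transcendental.KZDominatedFamilyRelations

/-!
# `NormalFormPrinciple` (stmt-KontsevichZagierPeriods-3869), line `SketchIdeator1` —
# leaf `stub_boxRigidity`, dilogarithm layer: dissection of the `ζ(2)` simplex at `z`

Pure proof file (registered sub-goal `zetaSimplex_dissect` of the layer `Dilog`, lead seat c9;
`--supports` the crux). Euler's REFLECTION formula
`Li₂(z) + Li₂(1 − z) + log z · log(1 − z) = ζ(2)` is, inside the Kontsevich–Zagier calculus, the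
scissors dissection of the `ζ(2)` simplex `S = [{0 < t₁ < t₀ < 1}, 1/(t₀(1 − t₁))]` by the two
lines `t₀ = z` and `t₁ = z` (`0 < z < 1`) into

* the lower triangle `A = {0 < t₁ < t₀ < z}` (value `Li₂ z`),
* the upper triangle `B = {z < t₁ < t₀ < 1}` (value `Li₂(1 − z)`),
* the rectangle `C = {0 < t₁ < z < t₀ < 1}` (value `log z · log(1 − z)`),

plus the two Lebesgue-null segments `S ∩ {t₀ = z}` and `S ∩ {t₁ = z}`. Given the four
representations (same integrand on their domains), `[S] − [A] − [B] − [C] ∈ KZ.relations` is pure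
rule-(1a) bookkeeping: split off the null segments (`KZ.IntegralRep.of_sub_of_restrict_mem_relations`,
coordinate hyperplanes being null by `Measure.pi_hyperplane`), then two domain-additivity moves
`A ⊔ (B ⊔ C)` and `B ⊔ C` along disjoint pieces (`KZ.domainAddRel`).

References: M. Kontsevich, D. Zagier, *Periods* (2001), §1.1–1.2, rule (1). No definitions are
introduced.
-/

noncomputable section

open MeasureTheory Set
open Literature.NumberTheory.Transcendental Literature.NumberTheory.Transcendental.KZ
open Literature.ModelTheory.ExponentialFields (IsSemialgebraic)

namespace Summit.KontsevichZagierPeriods.HurwitzMicroSectors.NormalFormPrinciple.PiBox.Dilog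

/-! ## The registered sub-goal -/

/-- **Stub S2 (`zetaSimplex_dissect`; registered sub-goal of stmt-KontsevichZagierPeriods-3869,
line `SketchIdeator1`, layer `Dilog`).** Dissection of the `ζ(2)` simplex
`S = [{0 < t₁ < t₀ < 1}, 1/(t₀(1 − t₁))]` at `z ∈ (0,1)` into the lower triangle
`A = {0 < t₁ < t₀ < z}`, the upper triangle `B = {z < t₁ < t₀ < 1}` and the rectangle
`C = {0 < t₁ < z < t₀ < 1}`: for any four representations with literally these domains and
integrands agreeing with `1/(t₀(1 − t₁))` on them, `[S] − [A] − [B] − [C] ∈ KZ.relations`.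
Moves: the complement of `A ∪ B ∪ C` in `S` lies in the two null hyperplanes `{t₀ = z}`,
`{t₁ = z}` and is split off by rule (1a) with a null piece; then `A ⊔ (B ⊔ C)` and `B ⊔ C` are two
domain-additivity moves along disjoint pieces. The algebraicity of `z` is not used (the pieces
are given). [cite: KontsevichZagier2001, §1.2 rule (1)] -/
theorem zetaSimplex_dissect {z : ℝ} (hz : IsAlgebraic ℚ z) (hz0 : 0 < z) (hz1 : z < 1)
    (S A B C : IntegralRep 2)
    (hSd : S.domain = {t | 0 < t 1 ∧ t 1 < t 0 ∧ t 0 < 1})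
    (hSi : EqOn S.integrand (fun t => 1 / (t 0 * (1 - t 1))) S.domain)
    (hAd : A.domain = {t | 0 < t 1 ∧ t 1 < t 0 ∧ t 0 < z})
    (hAi : EqOn A.integrand (fun t => 1 / (t 0 * (1 - t 1))) A.domain)
    (hBd : B.domain = {t | z < t 1 ∧ t 1 < t 0 ∧ t 0 < 1})
    (hBi : EqOn B.integrand (fun t => 1 / (t 0 * (1 - t 1))) B.domain)
    (hCd : C.domain = {t | 0 < t 1 ∧ t 1 < z ∧ z < t 0 ∧ t 0 < 1})
    (hCi : EqOn C.integrand (fun t => 1 / (t 0 * (1 - t 1))) C.domain) :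
    of S - of A - of B - of C ∈ relations := by
  have _ : IsAlgebraic ℚ z := hz
  clear hz
  -- semialgebraicity of the unions of the pieces
  have hBCσ : IsSemialgebraic ℚ (B.domain ∪ C.domain) :=
    B.isSemialgebraic_domain.union C.isSemialgebraic_domain
  have hEσ : IsSemialgebraic ℚ (A.domain ∪ (B.domain ∪ C.domain)) :=
    A.isSemialgebraic_domain.union hBCσ
  -- the pieces lie in the simplex
  have hBCsub : B.domain ∪ C.domain ⊆ S.domain := by
    rintro t (ht | ht)
    · rw [hBd] at ht
      obtain ⟨h1, h10, h0⟩ := ht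
      rw [hSd]
      exact ⟨hz0.trans h1, h10, h0⟩
    · rw [hCd] at ht
      obtain ⟨h1, h1z, hz0', h0⟩ := ht
      rw [hSd]
      exact ⟨h1, h1z.trans hz0', h0⟩
  have hEsub : A.domain ∪ (B.domain ∪ C.domain) ⊆ S.domain := by
    rintro t (ht | ht)
    · rw [hAd] at ht
      obtain ⟨h1, h10, h0⟩ := ht
      rw [hSd]
      exact ⟨h1, h10, h0.trans hz1⟩
    · exact hBCsub ht
  -- the complement of the pieces in the simplex lies in two null hyperplanes
  have hvol : volume (S.domain \ (A.domain ∪ (B.domain ∪ C.domain))) = 0 := by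
    refine measure_mono_null (fun t ht => ?_)
      (measure_union_null (Measure.pi_hyperplane (fun _ => (volume : Measure ℝ)) 0 z)
        (Measure.pi_hyperplane (fun _ => (volume : Measure ℝ)) 1 z))
    obtain ⟨htS, htE⟩ := ht
    rw [hSd] at htS
    obtain ⟨h1, h10, h0⟩ := htS
    simp only [hAd, hBd, hCd, mem_union, mem_setOf_eq, not_or] at htE
    obtain ⟨hA, hB, hC⟩ := htE
    rcases lt_trichotomy (t 0) z with hlt | heq | hgt
    · exact (hA ⟨h1, h10, hlt⟩).elim
    · exact Or.inl heq
    · rcases lt_trichotomy (t 1) z with hlt' | heq' | hgt'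
      · exact (hC ⟨h1, hlt', hgt, h0⟩).elim
      · exact Or.inr heq'
      · exact (hB ⟨hgt', h10, h0⟩).elim
  -- move 1: split off the null segments
  have e0 : of S - of (S.restrict _ hEσ hEsub) ∈ relations :=
    S.of_sub_of_restrict_mem_relations hEσ hEsub hvol
  -- move 2: `A ⊔ (B ⊔ C)` (disjoint pieces)
  have hABC : A.domain ∩ (B.domain ∪ C.domain) = ∅ := by
    rw [hAd, hBd, hCd]
    ext t
    simp only [mem_inter_iff, mem_union, mem_setOf_eq, mem_empty_iff_false, iff_false]
    rintro ⟨⟨_, _, hA⟩, ⟨hB, hB', _⟩ | ⟨_, _, hC, _⟩⟩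
    · exact lt_asymm hA (hB.trans hB')
    · exact lt_asymm hA hC
  have e1 : of (S.restrict _ hEσ hEsub) - of A - of (S.restrict _ hBCσ hBCsub) ∈ relations :=
    domainAddRel_subset_relations ⟨2, S.restrict _ hEσ hEsub, A, S.restrict _ hBCσ hBCsub, rfl,
      by rw [KZ.IntegralRep.domain_restrict, hABC, measure_empty],
      fun t ht => (hSi (hEsub (Or.inl ht))).trans (hAi ht).symm, fun _ _ => rfl, rfl⟩
  -- move 3: `B ⊔ C` (disjoint pieces)
  have hBC : B.domain ∩ C.domain = ∅ := by
    rw [hBd, hCd]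
    ext t
    simp only [mem_inter_iff, mem_setOf_eq, mem_empty_iff_false, iff_false]
    rintro ⟨⟨hB, _, _⟩, ⟨_, hC, _, _⟩⟩
    exact lt_asymm hB hC
  have e2 : of (S.restrict _ hBCσ hBCsub) - of B - of C ∈ relations :=
    domainAddRel_subset_relations ⟨2, S.restrict _ hBCσ hBCsub, B, C, rfl,
      by rw [hBC, measure_empty],
      fun t ht => (hSi (hBCsub (Or.inl ht))).trans (hBi ht).symm,
      fun t ht => (hSi (hBCsub (Or.inr ht))).trans (hCi ht).symm, rfl⟩
  have e : of S - of A - of B - of C =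
      (of S - of (S.restrict _ hEσ hEsub)) +
        (of (S.restrict _ hEσ hEsub) - of A - of (S.restrict _ hBCσ hBCsub)) +
        (of (S.restrict _ hBCσ hBCsub) - of B - of C) := by
    abel
  rw [e]
  exact relations.add_mem (relations.add_mem e0 e1) e2

end Summit.KontsevichZagierPeriods.HurwitzMicroSectors.NormalFormPrinciple.PiBox.Dilog
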